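import Summits.QuantumFields.YangMills.Theorems.BalabanUVNodesN11CondLawInFibreChartComposition

/-!
# DAG node N11 — FIBREWISE INSIDE CHARTS WITH PARAMETER-DEPENDENT WINDOWS GIVE THE WINDOWED CHART OF THE RECOORDINATISED INNER STEP
# `f U := (U_out, a_in U)` (kernel level) — the last link of the separated presentation of [III] §3 in this seat's socket

HEADER — WORK-UNIT METADATA.  Cell `pub-ymgap`, YM-PLAN Track A (HUMAN RULING D-0062), seat `pub-ymgap-dag-n08-w2` (g7; WIDTH SEAT 2∕4 on N08 [B10],
RE-POINTED to N11's [III] §3-supply residue), route `BalabanUVNodes` rev 25, item K1⁷ `StabilityBAtRecordR13SepCoPH` = stmt-QuantumFields-20542 (helper lane,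
`--kind proof --supports 20542 --as helper`, count-neutral).  [I] = [Balaban1987RG1], [III] = [Balaban1988Convergent], [15] = [Balaban1985Variational].
FILE 4 of this seat's kernel-level socket (FILE 1 `…N11CondLawInFibreChart` p611747 ✓ — the socket; FILE 2 `…N11TStepInFibreChart` p613290 ✓ — the record ∕ (†) ∕ first step;
FILE 3 `…N11CondLawInFibreChartComposition` p615387 ✓ — charts compose with un-charted disintegrations; the outer factor `avg_out × id`).  Over node00-def-T's
`T4AveragingDisintegration.jointLaw` and Mathlib (`Measure.prod`, `Kernel.comap`, Tonelli).  Companion (per-density, fixed charted set, NOT restated): dag-n11-w2 g3's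
`…KernelTransportSkewProduct.map_withDensity_skewChart_eq_restrict ∕ ae_avgRest_skewChart_eq` (p611138 §3).

WHY THIS FILE.  In [III] §3's separated presentation of `∫dU δ(ŪV⁻¹) …` (pp. 267–270) the INSIDE variables `U_in` are charted FIBREWISE IN THE OUTSIDE VARIABLES `U_out`
(the background, hence the exponential chart and the small-field window (3.2)–(3.5), read `U_out` and the new inside field `V_in`): for each `u_out` one has a chart of the
joint law of `(a_in(u_out, U_in), U_in)` under `dU_in = ν_in` on a window `(𝒮_in)_{u_out} ⊆ α_in × β_in`, with respect to `dV_in = μ_in`.  FILE 3 composes a windowed chart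
of the RECOORDINATISED inner step `f U := (U_out, a_in U)` (middle reference `λ = ν_out ⊗ μ_in`) with the un-charted outer step; THIS FILE supplies that chart from the
fibrewise family: with `κ_in : Kernel (β_out × α_in) X`, `Ψ_in : (β_out × α_in) × X → β_in`, `J_in : (β_out × α_in) × X → ℝ≥0`, a measurable window
`𝒮_in ⊆ β_out × (α_in × β_in)` and, for `ν_out`-a.e. `u_out`, the fibrewise identity
  `((μ_in ⊗ₘ κ_in(u_out, ·)).withDensity J_in((u_out, ·), ·)).map (z ↦ (z.1, Ψ_in((u_out, z.1), z.2))) = (jointLaw ν_in (a_in(u_out, ·))).restrict (𝒮_in)_{u_out}`,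
one gets FILE 1's hypothesis for `f` (★★★):
  `(((ν_out ⊗ μ_in) ⊗ₘ κ_in).withDensity J_in).map (z ↦ (z.1, (z.1.1, Ψ_in z))) = (jointLaw (ν_out ⊗ ν_in) f).restrict {(w, U) | U_out = w.1 ∧ (w.1, (w.2, U_in)) ∈ 𝒮_in}`
(Tonelli over `u_out`, the fibrewise identity inside, `Measure.ext_of_lintegral`).  Then FILE 3 ★★★ `chart_comp_of_disintegration` (outer step `g := avg_out × id`,
un-charted: def-T's ∕ 11a's true restricted transport) gives `hchart` for the whole skew averaging `U ↦ (avg_out U_out, a_in U)`, and FILE 1 ∕ FILE 2 give the conditional law,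
`kernelTransport`, def-T's (†) `tstepOfRecord` and the represented tower's pre-𝐑 slots in SEPARATED CHART CURRENCY — every density, every new sequence at once, with
`(U_out, V_in)`-dependent inner windows.

WHAT THIS FILE PROVES (0 `def`, 0 `sorry`, standard axioms; generic `{β₁ β₂ α₂ X}` = (out-fine, in-fine, in-coarse, chart coordinates)).
§1 `lintegral_innerChart_fibre` (the fibrewise identity integrated: one `u_out`) · `measurableSet_innerWindow` · ★★★ `chart_inner_of_fibrewise`.

HONEST FRAMING.  Helper lane of K1⁷; count-neutral; pure measure theory (Tonelli for `(ν_out ⊗ μ_in) ⊗ₘ κ_in` and `ν_out ⊗ ν_in`, `withDensity`, push-forward,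
`Measure.ext_of_lintegral`); NO chart constructed, NO Jacobian computed — the fibrewise identity is the HYPOTHESIS a Lie–Haar ∕ chart seat discharges for Bałaban's inside
chart; nothing of Bałaban ([I] §2, [III] §3 (3.10)–(3.25), [15] (47)–(49)) asserted; (S-α) ∕ (B4) NOT closed; N11 NOT discharged; N08 untouched; K1⁷ NOT closed; counts
unmoved (typed 28∕28 · discharged 5∕27).  One finite `𝕋⁴_{L^K}` programme at fixed `ε = L^{−K}`; R4 closes only the conditional finite-𝕋⁴ rung `BalabanLadder.UV` — NOT ℝ⁴,
NOT OS, NOT a mass gap, NOT Clay.  No `sorry`, `axiom`, `def`, `instance`, `notation`.  Sources (SHAPE ∕ bookkeeping only): [I] (0.4) p.253; [III] (2.21) p.258, (3.1) p.264,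
(3.2)–(3.5) p.265, (3.10)–(3.11) p.266, p.267 L18–24, p.270 L3–6; [15] (47)–(49) pp.287–288.
-/

noncomputable section

open MeasureTheory ProbabilityTheory
open scoped ENNReal NNReal

namespace Summit.QuantumFields.YangMills.Theorems.BalabanUVNodesN11CondLawInFibreChartInnerFamily

open Literature.MathematicalPhysics.QuantumFieldTheory.Balaban1983to89
open Literature.MathematicalPhysics.QuantumFieldTheory.Balaban1983to89.T4AveragingDisintegration

section InnerFamily

variable {β₁ β₂ α₂ X : Type*} [MeasurableSpace β₁] [MeasurableSpace β₂] [MeasurableSpace α₂] [MeasurableSpace X]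
variable {ν₁ : Measure β₁} [SFinite ν₁] {ν₂ : Measure β₂} [SFinite ν₂] {μ₂ : Measure α₂} [SFinite μ₂]
variable {a₂ : β₁ × β₂ → α₂} {κin : Kernel (β₁ × α₂) X} [IsSFiniteKernel κin]
variable {Ψin : (β₁ × α₂) × X → β₂} {Jin : (β₁ × α₂) × X → ℝ≥0} {𝒮in : Set (β₁ × (α₂ × β₂))}

omit [SFinite ν₁] [SFinite ν₂] in
/-- **THE FIBREWISE IDENTITY, INTEGRATED (one outside configuration `u₁`)**: if the inside chart at `u₁` charts the joint law of `(a_in(u₁,·), ·)` on the window slice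
`(𝒮_in)_{u₁}`, then for every measurable `G ≥ 0` on `(β_out × α_in) × (β_out × β_in)`,
`∫dμ_in(v₂) ∫κ_in((u₁,v₂),dx) J_in·G((u₁,v₂),(u₁,Ψ_in)) = ∫dν_in(u₂) 1_{𝒮_in}(u₁,(a_in(u₁,u₂),u₂))·G((u₁,a_in(u₁,u₂)),(u₁,u₂))`.
[cite: Balaban1988Convergent, (3.1) p.264, (3.10)–(3.11) p.266, p.267 L18–24 (bookkeeping: the inside integral at fixed outside variables)] -/
theorem lintegral_innerChart_fibre (ha₂ : Measurable a₂) (hΨin : Measurable Ψin) (hJin : Measurable Jin) (h𝒮in : MeasurableSet 𝒮in) (u₁ : β₁)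
    (hfib : ((μ₂ ⊗ₘ Kernel.comap κin (Prod.mk u₁) measurable_prodMk_left).withDensity
        (fun z => (Jin ((u₁, z.1), z.2) : ℝ≥0∞))).map (fun z => (z.1, Ψin ((u₁, z.1), z.2))) =
      (jointLaw ν₂ (fun u₂ => a₂ (u₁, u₂))).restrict (Prod.mk u₁ ⁻¹' 𝒮in))
    {G : (β₁ × α₂) × (β₁ × β₂) → ℝ≥0∞} (hG : Measurable G) :
    ∫⁻ v₂, ∫⁻ x, (Jin ((u₁, v₂), x) : ℝ≥0∞) * G ((u₁, v₂), (u₁, Ψin ((u₁, v₂), x))) ∂(κin (u₁, v₂)) ∂μ₂ =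
      ∫⁻ u₂, (Prod.mk u₁ ⁻¹' 𝒮in).indicator (fun _ => (1 : ℝ≥0∞)) (a₂ (u₁, u₂), u₂) * G ((u₁, a₂ (u₁, u₂)), (u₁, u₂)) ∂ν₂ := by
  have ha₂u : Measurable fun u₂ => a₂ (u₁, u₂) := ha₂.comp measurable_prodMk_left
  have hF : Measurable fun z : α₂ × X => (Jin ((u₁, z.1), z.2) : ℝ≥0∞) * G ((u₁, z.1), (u₁, Ψin ((u₁, z.1), z.2))) := by fun_prop
  have hGr : Measurable fun r : α₂ × β₂ => G ((u₁, r.1), (u₁, r.2)) := by fun_prop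
  calc ∫⁻ v₂, ∫⁻ x, (Jin ((u₁, v₂), x) : ℝ≥0∞) * G ((u₁, v₂), (u₁, Ψin ((u₁, v₂), x))) ∂(κin (u₁, v₂)) ∂μ₂
      = ∫⁻ z, (Jin ((u₁, z.1), z.2) : ℝ≥0∞) * G ((u₁, z.1), (u₁, Ψin ((u₁, z.1), z.2)))
          ∂(μ₂ ⊗ₘ Kernel.comap κin (Prod.mk u₁) measurable_prodMk_left) := by
        rw [Measure.lintegral_compProd hF]
        rfl
    _ = ∫⁻ r, G ((u₁, r.1), (u₁, r.2)) ∂(((μ₂ ⊗ₘ Kernel.comap κin (Prod.mk u₁) measurable_prodMk_left).withDensity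
          (fun z => (Jin ((u₁, z.1), z.2) : ℝ≥0∞))).map (fun z => (z.1, Ψin ((u₁, z.1), z.2)))) := by
        rw [lintegral_map hGr (show Measurable (fun z : α₂ × X => (z.1, Ψin ((u₁, z.1), z.2))) by fun_prop),
          lintegral_withDensity_eq_lintegral_mul _ (show Measurable (fun z : α₂ × X => (Jin ((u₁, z.1), z.2) : ℝ≥0∞)) by fun_prop)
            (show Measurable (fun z : α₂ × X => G ((u₁, z.1), (u₁, Ψin ((u₁, z.1), z.2)))) by fun_prop)]
        rfl
    _ = ∫⁻ r, G ((u₁, r.1), (u₁, r.2)) ∂((jointLaw ν₂ (fun u₂ => a₂ (u₁, u₂))).restrict (Prod.mk u₁ ⁻¹' 𝒮in)) := by rw [hfib]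
    _ = ∫⁻ r, (Prod.mk u₁ ⁻¹' 𝒮in).indicator (fun _ => (1 : ℝ≥0∞)) r * G ((u₁, r.1), (u₁, r.2)) ∂(jointLaw ν₂ (fun u₂ => a₂ (u₁, u₂))) := by
        rw [← lintegral_indicator (measurable_prodMk_left h𝒮in)]
        refine lintegral_congr fun r => ?_
        by_cases hr : r ∈ Prod.mk u₁ ⁻¹' 𝒮in
        · rw [Set.indicator_of_mem hr, Set.indicator_of_mem hr, one_mul]
        · rw [Set.indicator_of_notMem hr, Set.indicator_of_notMem hr, zero_mul]
    _ = ∫⁻ u₂, (Prod.mk u₁ ⁻¹' 𝒮in).indicator (fun _ => (1 : ℝ≥0∞)) (a₂ (u₁, u₂), u₂) * G ((u₁, a₂ (u₁, u₂)), (u₁, u₂)) ∂ν₂ := by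
        rw [jointLaw, lintegral_map (show Measurable (fun r : α₂ × β₂ =>
            (Prod.mk u₁ ⁻¹' 𝒮in).indicator (fun _ => (1 : ℝ≥0∞)) r * G ((u₁, r.1), (u₁, r.2))) from
          ((measurable_const.indicator (measurable_prodMk_left h𝒮in))).mul hGr) (measurable_graphMap ha₂u)]

omit [SFinite ν₁] [SFinite ν₂] [SFinite μ₂] [IsSFiniteKernel κin] in
/-- The window of the recoordinatised inner step, `{(w, U) | U_out = w.1 ∧ (w.1, (w.2, U_in)) ∈ 𝒮_in}`, is measurable (the outside fine space has a measurable diagonal).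
[cite: Balaban1988Convergent, (3.2)–(3.5) p.265 (bookkeeping: the inside window read at the outside variables)] -/
theorem measurableSet_innerWindow [MeasurableEq β₁] (h𝒮in : MeasurableSet 𝒮in) :
    MeasurableSet {p : (β₁ × α₂) × (β₁ × β₂) | p.2.1 = p.1.1 ∧ (p.1.1, (p.1.2, p.2.2)) ∈ 𝒮in} :=
  (measurableSet_eq_fun (measurable_snd.fst) (measurable_fst.fst)).inter
    ((show Measurable (fun p : (β₁ × α₂) × (β₁ × β₂) => (p.1.1, (p.1.2, p.2.2))) by fun_prop) h𝒮in)

/-- **★★★ FIBREWISE INSIDE CHARTS WITH PARAMETER-DEPENDENT WINDOWS GIVE THE WINDOWED CHART OF THE RECOORDINATISED INNER STEP**: for `f U := (U_out, a_in U)` on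
`β_out × β_in`, reference `dU = ν_out ⊗ ν_in`, middle reference `λ = ν_out ⊗ μ_in`, and a family `(κ_in, Ψ_in, J_in, 𝒮_in)` of inside charts satisfying the fibrewise identity
for `ν_out`-a.e. `u_out`:
`(((ν_out ⊗ μ_in) ⊗ₘ κ_in).withDensity J_in).map (z ↦ (z.1, (z.1.1, Ψ_in z))) = (jointLaw (ν_out ⊗ ν_in) f).restrict {(w, U) | U_out = w.1 ∧ (w.1, (w.2, U_in)) ∈ 𝒮_in}` —
FILE 1's hypothesis `hchart` for the inner step `f` with chart `(X, κ_in, z ↦ (z.1.1, Ψ_in z), J_in)`; compose with FILE 3 ★★★ along the un-charted outer step `avg_out × id`.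
[cite: Balaban1987RG1, (0.4) p.253; Balaban1988Convergent, (2.21) p.258, (3.1) p.264, (3.2)–(3.5) p.265, (3.10)–(3.11) p.266, p.267 L18–24, p.270 L3–6; Balaban1985Variational, (47)–(49) pp.287–288] -/
theorem chart_inner_of_fibrewise [MeasurableEq β₁] (ha₂ : Measurable a₂) (hΨin : Measurable Ψin) (hJin : Measurable Jin) (h𝒮in : MeasurableSet 𝒮in)
    (hfib : ∀ᵐ u₁ ∂ν₁, ((μ₂ ⊗ₘ Kernel.comap κin (Prod.mk u₁) measurable_prodMk_left).withDensity
        (fun z => (Jin ((u₁, z.1), z.2) : ℝ≥0∞))).map (fun z => (z.1, Ψin ((u₁, z.1), z.2))) =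
      (jointLaw ν₂ (fun u₂ => a₂ (u₁, u₂))).restrict (Prod.mk u₁ ⁻¹' 𝒮in)) :
    (((ν₁.prod μ₂) ⊗ₘ κin).withDensity (fun z => (Jin z : ℝ≥0∞))).map (fun z => (z.1, (z.1.1, Ψin z))) =
      (jointLaw (ν₁.prod ν₂) (fun u : β₁ × β₂ => (u.1, a₂ u))).restrict
        {p : (β₁ × α₂) × (β₁ × β₂) | p.2.1 = p.1.1 ∧ (p.1.1, (p.1.2, p.2.2)) ∈ 𝒮in} := by
  have hf : Measurable fun u : β₁ × β₂ => (u.1, a₂ u) := measurable_fst.prodMk ha₂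
  have h𝒮f := measurableSet_innerWindow (β₂ := β₂) (α₂ := α₂) (𝒮in := 𝒮in) h𝒮in
  refine Measure.ext_of_lintegral _ fun G hG => ?_
  have hφ : Measurable fun z : (β₁ × α₂) × X => (z.1, (z.1.1, Ψin z)) := by fun_prop
  have hJ : Measurable fun z : (β₁ × α₂) × X => (Jin z : ℝ≥0∞) := hJin.coe_nnreal_ennreal
  have hF : Measurable fun z : (β₁ × α₂) × X => (Jin z : ℝ≥0∞) * G (z.1, (z.1.1, Ψin z)) := hJ.mul (hG.comp hφ)
  -- left: Tonelli down to the outside variable, then the fibrewise identity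
  have hinner : Measurable fun w : β₁ × α₂ => ∫⁻ x, (Jin (w, x) : ℝ≥0∞) * G (w, (w.1, Ψin (w, x))) ∂(κin w) := hF.lintegral_kernel_prod_right'
  have hL : ∫⁻ p, G p ∂((((ν₁.prod μ₂) ⊗ₘ κin).withDensity (fun z => (Jin z : ℝ≥0∞))).map (fun z => (z.1, (z.1.1, Ψin z)))) =
      ∫⁻ u₁, ∫⁻ u₂, (Prod.mk u₁ ⁻¹' 𝒮in).indicator (fun _ => (1 : ℝ≥0∞)) (a₂ (u₁, u₂), u₂) * G ((u₁, a₂ (u₁, u₂)), (u₁, u₂)) ∂ν₂ ∂ν₁ := by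
    rw [lintegral_map hG hφ, lintegral_withDensity_eq_lintegral_mul _ hJ (show Measurable (fun z : (β₁ × α₂) × X => G (z.1, (z.1.1, Ψin z))) from hG.comp hφ)]
    change ∫⁻ z, (Jin z : ℝ≥0∞) * G (z.1, (z.1.1, Ψin z)) ∂((ν₁.prod μ₂) ⊗ₘ κin) = _
    rw [Measure.lintegral_compProd hF, MeasureTheory.lintegral_prod _ hinner.aemeasurable]
    refine lintegral_congr_ae ?_
    filter_upwards [hfib] with u₁ hu₁
    exact lintegral_innerChart_fibre ha₂ hΨin hJin h𝒮in u₁ hu₁ hG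
  -- right: the joint law of `(f U, U)` cut down to the window, Tonelli
  have hGf : Measurable fun u : β₁ × β₂ =>
      {p : (β₁ × α₂) × (β₁ × β₂) | p.2.1 = p.1.1 ∧ (p.1.1, (p.1.2, p.2.2)) ∈ 𝒮in}.indicator G ((u.1, a₂ u), u) :=
    (hG.indicator h𝒮f).comp (measurable_graphMap hf)
  have hR : ∫⁻ p, G p ∂((jointLaw (ν₁.prod ν₂) (fun u : β₁ × β₂ => (u.1, a₂ u))).restrict
        {p : (β₁ × α₂) × (β₁ × β₂) | p.2.1 = p.1.1 ∧ (p.1.1, (p.1.2, p.2.2)) ∈ 𝒮in}) =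
      ∫⁻ u₁, ∫⁻ u₂, (Prod.mk u₁ ⁻¹' 𝒮in).indicator (fun _ => (1 : ℝ≥0∞)) (a₂ (u₁, u₂), u₂) * G ((u₁, a₂ (u₁, u₂)), (u₁, u₂)) ∂ν₂ ∂ν₁ := by
    rw [← lintegral_indicator h𝒮f, jointLaw, lintegral_map (hG.indicator h𝒮f) (measurable_graphMap hf),
      MeasureTheory.lintegral_prod _ hGf.aemeasurable]
    refine lintegral_congr fun u₁ => lintegral_congr fun u₂ => ?_
    by_cases hu : (a₂ (u₁, u₂), u₂) ∈ Prod.mk u₁ ⁻¹' 𝒮in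
    · rw [Set.indicator_of_mem hu, one_mul,
        Set.indicator_of_mem (show (((u₁, u₂).1, a₂ (u₁, u₂)), (u₁, u₂)) ∈
          {p : (β₁ × α₂) × (β₁ × β₂) | p.2.1 = p.1.1 ∧ (p.1.1, (p.1.2, p.2.2)) ∈ 𝒮in} from ⟨rfl, hu⟩)]
    · rw [Set.indicator_of_notMem hu, zero_mul,
        Set.indicator_of_notMem (show (((u₁, u₂).1, a₂ (u₁, u₂)), (u₁, u₂)) ∉
          {p : (β₁ × α₂) × (β₁ × β₂) | p.2.1 = p.1.1 ∧ (p.1.1, (p.1.2, p.2.2)) ∈ 𝒮in} from fun h => hu h.2)]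
  rw [hL, hR]

end InnerFamily

end Summit.QuantumFields.YangMills.Theorems.BalabanUVNodesN11CondLawInFibreChartInnerFamily

end
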